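import Literature.NumberTheory.EllipticCurves.QuadraticSelmerStructure
import HarnessLib

/-!
# `H¹_{𝒮+𝒮'}` and Mazur–Rubin 2007 Prop. 1.3 (i) over KMR §3 (abstract quadratic Selmer structures)
# (cell `b2b-bsdres`, unit `b2b-bsdres-x10` = N2 class lead, GEN 30; TOOL — theorems and one
# definition with body over ABSTRACT localisation data; no named fact; nothing booked; file 1 of 4:
# `SelmerStructureSum` → `ResidualSelmerParity` → `ResidualSelmerGeneratorTest`, and
# `TateQuadraticFormsOdd` = KMR Lemma 3.4 abstract, the bilinear packaging of the instance)

HONEST FRAMING (run/shared/lean/b2b/bsd-rank1-residual/, verbatim in every file): the goal of the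
cell is to DELETE the COMBINATION-SHAPED residual classes of the Birch–Swinnerton-Dyer formula for
ALL analytic-rank `≤ 1` elliptic curves over `ℚ` — "full BSD formula for every rank `≤ 1` curve in
class `C`" assembled STRICTLY from published theorems — so that the rank-`≤ 1` remainder becomes
exactly the CONSTRUCTION-SHAPED classes, which are TYPED (missing-input `Prop`s), NOT attempted.
This is not "finishing BSD". Class X10b (= N2) keeps its label CONSTRUCTION-SHAPED (NEEDS `X_A3`,
referee R82.3 / RESIDUAL-MAP §I N2); this file is a TOOL; no mark / label / tier / count moves.

## What, and why it is abstract

x10 GEN 27 (`HOME/class-closure/N2/TRIVIAL-ROADS-x10g27.md` §1) decided every N2 cell by two laws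
read from print: (X) Selmer companions (kernel: `X10/SelmerCompanions*`, GEN 27–29) and (P) the
Tamagawa-parity law `dim Sel₃(E) − dim S⁰(E) ≡ #T_E (mod 2)` (Mazur–Rubin 2007 Thm. 1.4 for the
Kummer structure `𝓕` of `E[3]` and the RESIDUAL structure `𝓖`: `H¹_𝓖(ℚ_ℓ) = H¹_ur` for `ℓ ≠ 3`,
`H¹_𝓖(ℚ₃) = H¹_𝓕(ℚ₃)`; `S⁰(E) := H¹_𝓖(ℚ, E[3])`), with the GENERATOR TEST (G) = Mazur–Rubin 2007
Prop. 1.3 (i) + Thm. 1.4 at `#S = 1`. x10 GEN 29's SPEC (`HOME/class-closure/N2/P-SPEC-x10g29.md`)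
found the abstract parity theorem ALREADY PROVED in the tree:
`Literature/NumberTheory/EllipticCurves/QuadraticSelmerStructure.lean` proves Klagsbrun–Mazur–Rubin
2013 Thm. 3.9 for a `GlobalMetabolicStructure 𝓆` on abstract localisation data
`loc v : H →ₗ[F] L v`, `Λ v ≤ L v`, `S₀`, under the two arithmetic inputs of the printed proof
(`𝓆.IsSelfDualAt S` = Poitou–Tate; finite dimension of the classes unramified outside `S`). For odd
`p` a self-dual Selmer structure of MR07 Def. 1.2 is a Lagrangian family for the unique Tate
quadratic forms `q_v = ½⟨ , ⟩_v` (KMR Lemma 3.4), so MR07 §1 lives at this abstract level too.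

This file supplies, at that level (fact-free, any field `F`), the OTHER half of MR07 §1 used by (G):

* §1 `pi_sup_pi`; `finrank_sup_inf_add_finrank_inf` — for Lagrangians `X, Y, Z` of a nondegenerate
  quadratic space, `dim (X+Y) ∩ Z + dim X ∩ Y = dim X + dim X ∩ Y ∩ Z` (the tree's KMR Lemma 2.2
  Lagrangian `(X+Y) ∩ Z + X ∩ Y`); `finrank_comap_eq_finrank_ker_add`; the ALGEBRAIC SKELETON of
  **MR07 Prop. 1.3 (i)** `finrank_comap_sup_eq`: `dim loc⁻¹(X+Y) = dim loc⁻¹(X ∩ Y) + dim X/(X ∩ Y)`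
  for `loc : H → V` with Lagrangian image; `finrank_eq_of_natCard_eq_pow` (`#M = p^t ⟹ dim M = t`).
* §2 `sumSelmerGroup 𝒮 𝒮'` = `H¹_{𝒮+𝒮'}(K, T)` (MR07 Def. 1.2) and **MR07 Prop. 1.3 (i)** for two
  quadratic Selmer structures of one `𝓆`: `finrank_sumSelmerGroup_eq` —
  `dim H¹_{𝒮+𝒮'} = dim (H¹_𝒮 ∩ H¹_𝒮') + ∑_{v ∈ S} dim W_v/(W_v ∩ W'_v)`, under the same two
  inputs as Thm. 3.9 (MR07's proof: "Poitou–Tate global duality shows … `C` is its own orthogonal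
  complement", "`dim C = dim C_𝓕 = ½ dim B`").

The intended instance (`T = E[p]`, `p` odd, `𝓆 = (½⟨x,x⟩_v)` the unique global metabolic structure
on `E[p]`, KMR Lemma 3.4 / §5 / Lemma 5.3) is described in `X10/ResidualSelmerParity.lean`; it is
NOT built here (that is where the named facts live — P-SPEC (I1)–(I6)).

## References

* [KlagsbrunMazurRubin2013] Z. Klagsbrun, B. Mazur, K. Rubin, *Disparity in Selmer ranks of
  quadratic twists of elliptic curves*, Ann. of Math. 178 (2013), §2 (Lemma 2.2, Prop. 2.4), §3
  (Thm. 3.1, Def. 3.3, Lemma 3.4, Def. 3.8, Thm. 3.9), §5 (Lemma 5.3) — arXiv:1111.2321, read.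
* [MazurRubin2007] B. Mazur, K. Rubin, *Finding large Selmer rank via an arithmetic theory of local
  constants*, Ann. of Math. 166 (2007), Def. 1.2, Prop. 1.3, Thm. 1.4, Prop. 2.1 —
  arXiv:math/0512085 pp. 5–6, read (verbatim in HOME/class-closure/N2/TRIVIAL-ROADS-x10g27.md §1).
* HOME/class-closure/N2/{TRIVIAL-ROADS-x10g27.md §§1–3, §9; P-SPEC-x10g29.md}; HOME/X10-AUDIT.md §§33–36.
-/

set_option autoImplicit false

noncomputable section

open Module QuadraticMap Literature.LinearAlgebra.QuadraticForm Literature.NumberTheory.EllipticCurves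

namespace Summit.BirchSwinnertonDyer.Rank1Residual.X10.SelmerStructureSum

universe u v w x

/-! ### §1. Linear algebra: `Π(N ⊔ N')`, the Lagrangian `(X+Y) ∩ Z + X ∩ Y`, and MR07 Prop. 1.3 (i) -/

section LinearAlgebra

variable {F : Type u} [Field F]

/-- `(Πᵢ Nᵢ) + (Πᵢ N'ᵢ) = Πᵢ (Nᵢ + N'ᵢ)` over a finite index type (componentwise decomposition).
[folklore] -/
theorem pi_sup_pi {ι : Type w} [Finite ι] {M : ι → Type v} [∀ i, AddCommGroup (M i)]
    [∀ i, Module F (M i)] (N N' : ∀ i, Submodule F (M i)) :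
    Submodule.pi Set.univ N ⊔ Submodule.pi Set.univ N' =
      Submodule.pi Set.univ fun i => N i ⊔ N' i := by
  refine le_antisymm (sup_le (Submodule.pi_mono fun i _ => le_sup_left)
    (Submodule.pi_mono fun i _ => le_sup_right)) fun x hx => ?_
  rw [Submodule.mem_pi] at hx
  choose a ha b hb hab using fun i => Submodule.mem_sup.mp (hx i (Set.mem_univ i))
  rw [Submodule.mem_sup]
  refine ⟨a, fun i _ => ha i, b, fun i _ => hb i, funext fun i => ?_⟩
  rw [Pi.add_apply, hab i]

variable {V : Type v} [AddCommGroup V] [Module F V] [FiniteDimensional F V]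
  {Q : QuadraticForm F V}

/-- For Lagrangian subspaces `X, Y, Z` of a nondegenerate quadratic space,
`dim ((X+Y) ∩ Z) + dim (X ∩ Y) = dim X + dim (X ∩ Y ∩ Z)`: the subspace `(X+Y) ∩ Z + X ∩ Y` is
Lagrangian (Klagsbrun–Mazur–Rubin 2013 Lemma 2.2 with `W = X ∩ Y`, `W^⊥ = X + Y`; the tree's
`isLagrangian_sup_inf_sup_inf`), hence of dimension `dim X`, and meets as displayed. This is the
count behind Mazur–Rubin 2007 Prop. 1.3 (i) (`C`, `C_𝓕` both of dimension `½ dim B`).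
[cite: KlagsbrunMazurRubin2013, Lemma 2.2 and Prop. 2.4 (proof)] -/
theorem finrank_sup_inf_add_finrank_inf (hnd : (polarForm Q).Nondegenerate) {X Y Z : Submodule F V}
    (hX : IsLagrangian Q X) (hY : IsLagrangian Q Y) (hZ : IsLagrangian Q Z) :
    finrank F ↥((X ⊔ Y) ⊓ Z) + finrank F ↥(X ⊓ Y) = finrank F X + finrank F ↥(X ⊓ Y ⊓ Z) := by
  have e3 := Submodule.finrank_sup_add_finrank_inf_eq ((X ⊔ Y) ⊓ Z) (X ⊓ Y)
  have hT2 : ((X ⊔ Y) ⊓ Z) ⊓ (X ⊓ Y) = X ⊓ Y ⊓ Z :=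
    le_antisymm (le_inf inf_le_right (inf_le_left.trans inf_le_right))
      (le_inf (le_inf (inf_le_left.trans (inf_le_left.trans le_sup_left)) inf_le_right) inf_le_left)
  rw [hT2] at e3
  have e4 : finrank F ↥(((X ⊔ Y) ⊓ Z) ⊔ (X ⊓ Y)) = finrank F X := by
    have h := (isLagrangian_sup_inf_sup_inf hnd hX hY hZ).two_mul_finrank hnd
    have h' := hX.two_mul_finrank hnd
    omega
  omega

/-- Rank–nullity for `loc` restricted to `loc⁻¹(W)`: `dim loc⁻¹(W) = dim ker loc + dim (W ∩ im loc)`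
(the exact sequences `0 → A → H¹_𝒮(K, T) → X ∩ Z → 0` of the proof of KMR Thm. 3.9). [folklore] -/
theorem finrank_comap_eq_finrank_ker_add {H : Type w} [AddCommGroup H] [Module F H]
    [FiniteDimensional F H] (loc : H →ₗ[F] V) (W : Submodule F V) :
    finrank F ↥(W.comap loc) =
      finrank F ↥(LinearMap.ker loc) + finrank F ↥(W ⊓ LinearMap.range loc) := by
  let f : ↥(W.comap loc) →ₗ[F] V := loc ∘ₗ (W.comap loc).subtype
  have hrange : LinearMap.range f = W ⊓ LinearMap.range loc := by
    ext y
    constructor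
    · rintro ⟨⟨h, hh⟩, rfl⟩
      exact ⟨hh, ⟨h, rfl⟩⟩
    · rintro ⟨hy, h, rfl⟩
      exact ⟨⟨h, hy⟩, rfl⟩
  have hle : LinearMap.ker loc ≤ W.comap loc := fun h hh => by
    rw [Submodule.mem_comap, LinearMap.mem_ker.1 hh]
    exact W.zero_mem
  have hker : LinearMap.ker f = (LinearMap.ker loc).comap (W.comap loc).subtype := by
    ext ⟨h, hh⟩
    rfl
  have rn := LinearMap.finrank_range_add_finrank_ker f
  rw [hrange, hker, (Submodule.comapSubtypeEquivOfLe hle).finrank_eq] at rn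
  omega

/-- **Mazur–Rubin 2007 Prop. 1.3 (i), algebraic skeleton.** For `loc : H → V` with Lagrangian image
`Z` and Lagrangians `X, Y` of a nondegenerate quadratic space `V`:
`dim loc⁻¹(X + Y) = dim loc⁻¹(X ∩ Y) + dim X/(X ∩ Y)`. (In MR07: `H = H¹(K_S/K, T)`,
`V = ⊕_{v ∈ S} H¹(K_v, T)`, `X = ⊕ H¹_𝓕(K_v)`, `Y = ⊕ H¹_𝓖(K_v)`, `loc⁻¹(X+Y) = H¹_{𝓕+𝓖}(K, T)`,
`loc⁻¹(X ∩ Y) = H¹_{𝓕∩𝓖}(K, T)`; "`dim C = dim C_𝓕 = ½ dim B`".) Proof: both preimages contain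
`ker loc`, and `dim (X+Y) ∩ Z − dim X ∩ Y ∩ Z = dim X − dim X ∩ Y` by
`finrank_sup_inf_add_finrank_inf`. [cite: MazurRubin2007, Prop. 1.3 (i)]
[cite: KlagsbrunMazurRubin2013, Lemma 2.2] -/
theorem finrank_comap_sup_eq (hnd : (polarForm Q).Nondegenerate) {X Y : Submodule F V}
    (hX : IsLagrangian Q X) (hY : IsLagrangian Q Y) {H : Type w} [AddCommGroup H] [Module F H]
    [FiniteDimensional F H] (loc : H →ₗ[F] V) (hZ : IsLagrangian Q (LinearMap.range loc)) :
    finrank F ↥((X ⊔ Y).comap loc) =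
      finrank F ↥((X ⊓ Y).comap loc) + (finrank F X - finrank F ↥(X ⊓ Y)) := by
  have h1 := finrank_comap_eq_finrank_ker_add loc (X ⊔ Y)
  have h2 := finrank_comap_eq_finrank_ker_add loc (X ⊓ Y)
  have h3 := finrank_sup_inf_add_finrank_inf hnd hX hY hZ
  have l1 : finrank F ↥(X ⊓ Y) ≤ finrank F X := Submodule.finrank_mono inf_le_left
  have l2 : finrank F ↥(X ⊓ Y ⊓ LinearMap.range loc) ≤ finrank F ↥(X ⊓ Y) :=
    Submodule.finrank_mono inf_le_left
  omega

/-- Over `𝔽_p`: `#M = p^t ⟹ dim_{𝔽_p} M = t` (the order currency `#Sel = p^s` of the tree's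
`p`-Selmer statements). [folklore] -/
theorem finrank_eq_of_natCard_eq_pow {p : ℕ} [Fact p.Prime] {M : Type w} [AddCommGroup M]
    [Module (ZMod p) M] [Module.Finite (ZMod p) M] {t : ℕ} (h : Nat.card M = p ^ t) :
    finrank (ZMod p) M = t := by
  haveI : Finite M := Module.finite_of_finite (ZMod p)
  have e := Literature.GroupTheory.FiniteAbelian.pow_finrank_eq_natCard p M
  rw [h] at e
  exact Nat.pow_right_injective (Fact.out : p.Prime).two_le e

end LinearAlgebra

/-! ### §2. `H¹_{𝒮+𝒮'}` and Mazur–Rubin 2007 Prop. 1.3 (i) for quadratic Selmer structures -/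

section Structures

variable {F : Type u} [Field F] {ι : Type v} {H : Type w} [AddCommGroup H] [Module F H]
  {L : ι → Type x} [∀ v, AddCommGroup (L v)] [∀ v, Module F (L v)]
  {loc : ∀ v, H →ₗ[F] L v} {Λ : ∀ v, Submodule F (L v)} {S₀ : Finset ι}
  {𝓆 : GlobalMetabolicStructure loc Λ S₀}

/-- The Selmer group `H¹_{𝒮+𝒮'}(K, T) = {c : loc_v c ∈ W_v + W'_v for every v}` of the SUM of two
Selmer structures (Mazur–Rubin 2007 Def. 1.2: `H¹_{𝓕+𝓖}(K_v, T) := H¹_𝓕(K_v, T) + H¹_𝓖(K_v, T)`;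
not itself a quadratic Selmer structure — `W_v + W'_v` is coisotropic, not Lagrangian).
[cite: MazurRubin2007, Def. 1.2] -/
def sumSelmerGroup (𝒮 𝒮' : QuadraticSelmerStructure 𝓆) : Submodule F H :=
  ⨅ v, (𝒮.W v ⊔ 𝒮'.W v).comap (loc v)

/-- Membership in `H¹_{𝒮+𝒮'}`. [cite: MazurRubin2007, Def. 1.2] -/
@[simp] theorem mem_sumSelmerGroup_iff (𝒮 𝒮' : QuadraticSelmerStructure 𝓆) (c : H) :
    c ∈ sumSelmerGroup 𝒮 𝒮' ↔ ∀ v, loc v c ∈ 𝒮.W v ⊔ 𝒮'.W v := by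
  simp [sumSelmerGroup, Submodule.mem_iInf]

/-- `H¹_𝒮 ≤ H¹_{𝒮+𝒮'}`. [cite: MazurRubin2007, Def. 1.2] -/
theorem selmerGroup_le_sumSelmerGroup_left (𝒮 𝒮' : QuadraticSelmerStructure 𝓆) :
    𝒮.selmerGroup ≤ sumSelmerGroup 𝒮 𝒮' := fun c hc =>
  (mem_sumSelmerGroup_iff 𝒮 𝒮' c).mpr fun v =>
    Submodule.mem_sup_left ((𝒮.mem_selmerGroup_iff c).mp hc v)

/-- `H¹_𝒮' ≤ H¹_{𝒮+𝒮'}`. [cite: MazurRubin2007, Def. 1.2] -/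
theorem selmerGroup_le_sumSelmerGroup_right (𝒮 𝒮' : QuadraticSelmerStructure 𝓆) :
    𝒮'.selmerGroup ≤ sumSelmerGroup 𝒮 𝒮' := fun c hc =>
  (mem_sumSelmerGroup_iff 𝒮 𝒮' c).mpr fun v =>
    Submodule.mem_sup_right ((𝒮'.mem_selmerGroup_iff c).mp hc v)

/-- `H¹_{𝒮∩𝒮'}(K, T) = H¹_𝒮 ∩ H¹_𝒮'`: membership (Mazur–Rubin 2007 Def. 1.2:
`H¹_{𝓕∩𝓖}(K_v, T) := H¹_𝓕(K_v, T) ∩ H¹_𝓖(K_v, T)`). [cite: MazurRubin2007, Def. 1.2] -/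
theorem mem_selmerGroup_inf_iff (𝒮 𝒮' : QuadraticSelmerStructure 𝓆) (c : H) :
    c ∈ 𝒮.selmerGroup ⊓ 𝒮'.selmerGroup ↔ ∀ v, loc v c ∈ 𝒮.W v ⊓ 𝒮'.W v := by
  simp only [Submodule.mem_inf, QuadraticSelmerStructure.mem_selmerGroup_iff]
  exact ⟨fun h v => ⟨h.1 v, h.2 v⟩, fun h => ⟨fun v => (h v).1, fun v => (h v).2⟩⟩

/-- `H¹_{𝒮+𝒮'}` consists of classes unramified outside any `S ⊇ Σ_𝒮 ∪ Σ_𝒮'` (off `S` both local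
conditions are `Λ v`, and `Λ v + Λ v = Λ v`). [cite: MazurRubin2007, Prop. 1.3 (proof)] -/
theorem sumSelmerGroup_le_unramifiedOutside (𝒮 𝒮' : QuadraticSelmerStructure 𝓆) {S : Finset ι}
    (hS : 𝒮.places ⊆ S) (hS' : 𝒮'.places ⊆ S) :
    sumSelmerGroup 𝒮 𝒮' ≤ unramifiedOutside loc Λ S := by
  intro c hc
  rw [mem_unramifiedOutside_iff]
  intro v hv
  have h := (mem_sumSelmerGroup_iff 𝒮 𝒮' c).mp hc v
  rwa [𝒮.eq_unramified v fun h' => hv (hS h'), 𝒮'.eq_unramified v fun h' => hv (hS' h'),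
    sup_idem] at h

/-- `H¹_{𝒮+𝒮'}` is the preimage of `X + Y = ⊕_{v ∈ S} (W_v + W'_v)` under `loc_S` on the classes
unramified outside `S` (the identification `C ≅ H¹_{𝓕+𝓖}(K,T)/H¹_{𝓕∩𝓖}(K,T)` of MR07's proof).
[cite: MazurRubin2007, Prop. 1.3 (proof)] -/
theorem comap_locPi_pi_sup_eq (𝒮 𝒮' : QuadraticSelmerStructure 𝓆) {S : Finset ι}
    (hS : 𝒮.places ⊆ S) (hS' : 𝒮'.places ⊆ S) :
    (Submodule.pi Set.univ fun v : S => 𝒮.W v ⊔ 𝒮'.W v).comap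
        ((locPi loc S).comp (unramifiedOutside loc Λ S).subtype) =
      (sumSelmerGroup 𝒮 𝒮').comap (unramifiedOutside loc Λ S).subtype := by
  ext c
  simp only [Submodule.mem_comap, LinearMap.coe_comp, Function.comp_apply, Submodule.subtype_apply,
    Submodule.mem_pi, Set.mem_univ, true_imp_iff, locPi_apply, mem_sumSelmerGroup_iff]
  refine ⟨fun h v => ?_, fun h v => h v⟩
  by_cases hv : v ∈ S
  · exact h ⟨v, hv⟩
  · rw [𝒮.eq_unramified v fun h' => hv (hS h'), 𝒮'.eq_unramified v fun h' => hv (hS' h'),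
      sup_idem]
    exact (mem_unramifiedOutside_iff loc Λ S (c : H)).mp c.2 v hv

/-- `H¹_𝒮 ∩ H¹_𝒮'` is the preimage of `X ∩ Y = ⊕_{v ∈ S} (W_v ∩ W'_v)` under `loc_S` on the classes
unramified outside `S`. [cite: MazurRubin2007, Prop. 1.3 (proof)] -/
theorem comap_locPi_pi_inf_eq (𝒮 𝒮' : QuadraticSelmerStructure 𝓆) {S : Finset ι}
    (hS : 𝒮.places ⊆ S) (hS' : 𝒮'.places ⊆ S) :
    (Submodule.pi Set.univ fun v : S => 𝒮.W v ⊓ 𝒮'.W v).comap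
        ((locPi loc S).comp (unramifiedOutside loc Λ S).subtype) =
      (𝒮.selmerGroup ⊓ 𝒮'.selmerGroup).comap (unramifiedOutside loc Λ S).subtype := by
  ext c
  simp only [Submodule.mem_comap, LinearMap.coe_comp, Function.comp_apply, Submodule.subtype_apply,
    Submodule.mem_pi, Set.mem_univ, true_imp_iff, locPi_apply, mem_selmerGroup_inf_iff]
  refine ⟨fun h v => ?_, fun h v => h v⟩
  by_cases hv : v ∈ S
  · exact h ⟨v, hv⟩
  · rw [𝒮.eq_unramified v fun h' => hv (hS h'), 𝒮'.eq_unramified v fun h' => hv (hS' h'),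
      inf_idem]
    exact (mem_unramifiedOutside_iff loc Λ S (c : H)).mp c.2 v hv

/-- **Mazur–Rubin 2007 Prop. 1.3 (i)** for two quadratic Selmer structures `𝒮, 𝒮'` of one global
metabolic structure (verbatim: "Suppose that `𝓕, 𝓖` are self-dual Selmer structures on `T`, and `S`
is a finite set of primes of `K` such that `H¹_𝓕(K_v,T) = H¹_𝓖(K_v,T)` if `v ∉ S`. Then
`dim H¹_{𝓕+𝓖}(K,T)/H¹_{𝓕∩𝓖}(K,T) = ∑_{v ∈ S} dim H¹_𝓕(K_v,T)/H¹_{𝓕∩𝓖}(K_v,T)`"), for any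
finite `S ⊇ Σ_𝒮 ∪ Σ_𝒮'` under the Poitou–Tate and finiteness inputs of KMR Thm. 3.9:
`dim H¹_{𝒮+𝒮'} = dim (H¹_𝒮 ∩ H¹_𝒮') + ∑_{v ∈ S} (dim W_v − dim W_v ∩ W'_v)`. Proof: MR07's
`dim C = dim C_𝓕 = ½ dim B` is `finrank_comap_sup_eq` in `V = ⊕_{v ∈ S} L v` with
`X = ⊕ W_v`, `Y = ⊕ W'_v`, `Z = loc_S(H_S)` Lagrangian. [cite: MazurRubin2007, Prop. 1.3 (i)]
[cite: KlagsbrunMazurRubin2013, Thm. 3.9 (proof)] -/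
theorem finrank_sumSelmerGroup_eq [∀ v, FiniteDimensional F (L v)]
    (𝒮 𝒮' : QuadraticSelmerStructure 𝓆) {S : Finset ι} (hS : 𝒮.places ⊆ S)
    (hS' : 𝒮'.places ⊆ S) (hfin : FiniteDimensional F (unramifiedOutside loc Λ S))
    (hPT : 𝓆.IsSelfDualAt S) :
    finrank F ↥(sumSelmerGroup 𝒮 𝒮') =
      finrank F ↥(𝒮.selmerGroup ⊓ 𝒮'.selmerGroup) +
        ∑ v ∈ S, (finrank F (𝒮.W v) - finrank F ↥(𝒮.W v ⊓ 𝒮'.W v)) := by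
  have hS₀ : S₀ ⊆ S := 𝒮.subset_places.trans hS
  haveI := hfin
  have hmet : IsMetabolic (𝓆.piForm S) := 𝓆.isMetabolic_piForm S
  have hX : IsLagrangian (𝓆.piForm S) (Submodule.pi Set.univ fun v : S => 𝒮.W v) :=
    IsLagrangian.pi fun v : S => 𝒮.isLagrangian v
  have hY : IsLagrangian (𝓆.piForm S) (Submodule.pi Set.univ fun v : S => 𝒮'.W v) :=
    IsLagrangian.pi fun v : S => 𝒮'.isLagrangian v
  have hZ : IsLagrangian (𝓆.piForm S)
      (LinearMap.range ((locPi loc S).comp (unramifiedOutside loc Λ S).subtype)) := by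
    rw [range_locPi_comp_subtype]
    exact 𝓆.isLagrangian_globalImage hS₀ hPT
  have key := finrank_comap_sup_eq hmet.1 hX hY
    ((locPi loc S).comp (unramifiedOutside loc Λ S).subtype) hZ
  rw [pi_sup_pi, pi_inf_pi, comap_locPi_pi_sup_eq 𝒮 𝒮' hS hS', comap_locPi_pi_inf_eq 𝒮 𝒮' hS hS',
    (Submodule.comapSubtypeEquivOfLe (sumSelmerGroup_le_unramifiedOutside 𝒮 𝒮' hS hS')).finrank_eq,
    (Submodule.comapSubtypeEquivOfLe
      ((inf_le_left : 𝒮.selmerGroup ⊓ 𝒮'.selmerGroup ≤ 𝒮.selmerGroup).trans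
        (𝒮.selmerGroup_le_unramifiedOutside hS))).finrank_eq,
    finrank_pi_eq_sum, finrank_pi_eq_sum,
    Finset.sum_coe_sort S fun v => finrank F (𝒮.W v),
    Finset.sum_coe_sort S fun v => finrank F ↥(𝒮.W v ⊓ 𝒮'.W v)] at key
  have hle : ∀ v ∈ S, finrank F ↥(𝒮.W v ⊓ 𝒮'.W v) ≤ finrank F (𝒮.W v) := fun v _ =>
    Submodule.finrank_mono inf_le_left
  rwa [Finset.sum_tsub_distrib S hle]

end Structures

end Summit.BirchSwinnertonDyer.Rank1Residual.X10.SelmerStructureSum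

end
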